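import Mathlib
import Literature.AlgebraicGeometry.Resolution.WeightedResolutionDatum
import Literature.AlgebraicGeometry.Resolution.CobordantBlowupGlobal
import Literature.AlgebraicGeometry.Resolution.MarkedIdealsLemmas
import Summits.ResolutionOfSingularities.ResolutionOfSingularities.Theorems.WeightedInvariantDefs
import Summits.ResolutionOfSingularities.ResolutionOfSingularities.Theorems.WeightedInvariantDatumToEmbeddedDegreeRees
import Summits.ResolutionOfSingularities.ResolutionOfSingularities.Theorems.WeightedInvariantDatumToEmbeddedDegreeCartier
import Summits.ResolutionOfSingularities.ResolutionOfSingularities.Theorems.WeightedInvariantWeightedThesisGlobalCobordantPlus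
import Summits.ResolutionOfSingularities.ResolutionOfSingularities.Theorems.WeightedInvariantWeightedConstructionExtReesRegular
import HarnessLib

/-!
# Choice of the Veronese degree of the downstairs centre

Topic: `Summits/ResolutionOfSingularities/ResolutionOfSingularities/Theorems`. Stub `stub_qs_degree`
of the line `Sketch` of the crux `Theses.WeightedInvariant.DatumToEmbedded` (statement
`stmt-ResolutionOfSingularities-0572`) of the summit
`Summit.ResolutionOfSingularities.ResolutionOfSingularities`.

Setting (Włodarczyk, arXiv:2203.03090, §2.3.3: the torus quotient of the cobordant blow-up `B₊` of
`X ⊆ Y` is the blow-up of the quotient `V = X⫽𝔾ₘʲ` along the invariant part of a Veronese piece of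
the centre). Data: a weighted resolution datum `D` (`Literature/…/WeightedResolutionDatum.lean`), a
closed immersion `i : X ⟶ Y` of an integral `X` into `f : Y → Spec k` smooth separated
quasi-compact over a perfect field, a presentation `q : X ⟶ V` by a graded atlas
`𝒜 : GradedAtlas j f i q` (`Theorems/WeightedInvariantDefs.lean`), the guard of axiom `(iii)`,
homogeneity of the pieces `Jₙ` of the centre on the charts, the Rees filtration `R'` of the centre
with its global cobordant blow-up `σ₊ : B₊ = R'.plus ⟶ Y`
(`Literature/…/CobordantBlowupGlobal.lean`),
the strict transform `X' = V(R'.strictTransformPlus (ker i))` over `X` (`σX`), and the exceptional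
identity (A1) `J_D · 𝒪_{B₊} = (t⁻¹)^D` for all multiples `D` of `N₀` (stub `stub_qs_exceptional`).
Conclusion: a degree `Dg = e · N₀ · ∏ₐ dₐ` (`e` the exponent of the atlas) with

* (A2) on every chart `a`, the degree-`0` parts of the `J_{Dg·l}(W a)` are generated in degree one:
  `(J_{Dg(l+1)})₀ ⊆ (J_{Dg})₀ · (J_{Dg l})₀` already in `Γ(Y, W a)` (so a fortiori modulo the
  ideal of `X`) — `exists_veronese_chart`, from `…DegreeRees.veronese_degreeZero` applied to the
  `ℤʲ`-graded `Γ(Y, W a)` over `Γ(Spec k)` (finite type: `f` is locally of finite type) and the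
  filtration `Jₙ(W a)` (homogeneous; extended Rees algebra of finite type over `Γ(Y, W a)` for ANY
  affine open by `ExtReesRegular.finiteType` and `sectionsRing_eq_extReesAlgebra`);
* (A3) the downstairs centre `K = q_*(J_Dg · 𝒪_X)` (Mathlib `IdealSheafData.map`, written as the
  kernel of `V(J_Dg · 𝒪_X) ⟶ X ⟶ V`) pulls back to `(t⁻¹)^Dg` on `X'`: `⊆` formally from (A1) at
  `Dg` (`comap_map_le`), `⊇` from (A1) at `Dg/e` by `…DegreeCartier.pow_comap_le_comap_map`
  (one homogeneous local generator of `J_{Dg/e}` and a homogeneous unit of the opposite degree).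

All proofs are glue on Mathlib and the tree; no definitions, no named facts.
-/

noncomputable section

open CategoryTheory CategoryTheory.Limits AlgebraicGeometry TopologicalSpace
open Literature.AlgebraicGeometry.Resolution
open Summit.ResolutionOfSingularities.ResolutionOfSingularities.Theorems

set_option linter.dupNamespace false -- mandated namespace `…Theorems.DatumToEmbedded.<Topic>`
-- `Γ(Y, U)` versus `Y.presheaf.obj (op U)` inside `rw` motives and instance problems on the glued
-- scheme `R'.cobordantBlowup` (as in `…DatumToEmbedded.InvDrop` / `.Exceptional`):
set_option backward.isDefEq.respectTransparency false

namespace Summit.ResolutionOfSingularities.ResolutionOfSingularities.Theorems.DatumToEmbedded.Degree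

/-! ## (A2) on one chart -/

section Chart

variable {p : ℕ} (D : WeightedResolutionDatum p) {k : Type} [Field k] [CharP k p] [PerfectField k]
  {Y X V : Scheme.{0}} (f : Y ⟶ Spec (.of k)) [Smooth f] [IsSeparated f] [QuasiCompact f]
  (i : X ⟶ Y) [IsClosedImmersion i] (q : X ⟶ V) {j : ℕ} (𝒜 : GradedAtlas j f i q)
  (hguard : ∃ y : Y, ¬ IsBot (D.inv f i.ker y))
  (hhom : ∀ (a : 𝒜.ι) (n : ℕ), letI := 𝒜.gradedRing a;
    (((D.centre f i.ker).piece n).ideal (𝒜.W a)).IsHomogeneous (𝒜.piece a))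
  (R' : ReesFiltration Y) (hR' : R'.ideal = (D.centre f i.ker).piece)

include hguard hhom R' hR' in
/-- **(A2) on one chart of the atlas**: on the `ℤʲ`-graded chart ring `A = Γ(Y, W a)` (of finite
type over `Γ(Spec k)`, scalars in degree `0`) the pieces `Jₙ(W a)` of the centre are homogeneous
and their extended Rees algebra is of finite type over `A` (`ExtReesRegular.finiteType`, any affine
open of a regular weighted centre), so `…DegreeRees.veronese_degreeZero` gives `dₐ > 0` such that
for all multiples `d'` of `dₐ` the degree-`0` part of `J_{d'(l+1)}(W a)` lies in the additive
closure of the products of degree-`0` elements of `J_{d'}(W a)` and `J_{d'l}(W a)`.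
[cite: Wlodarczyk2022, §2.3.3] -/
theorem exists_veronese_chart (a : 𝒜.ι) :
    ∃ d : ℕ, 0 < d ∧ ∀ d' : ℕ, d ∣ d' → ∀ (l : ℕ) (x : Γ(Y, 𝒜.W a)),
      x ∈ ((D.centre f i.ker).piece (d' * (l + 1))).ideal (𝒜.W a) → x ∈ 𝒜.piece a 0 →
      x ∈ AddSubgroup.closure {z : Γ(Y, 𝒜.W a) | ∃ u v : Γ(Y, 𝒜.W a),
        u ∈ ((D.centre f i.ker).piece d').ideal (𝒜.W a) ∧ u ∈ 𝒜.piece a 0 ∧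
        v ∈ ((D.centre f i.ker).piece (d' * l)).ideal (𝒜.W a) ∧ v ∈ 𝒜.piece a 0 ∧
        z = u * v} := by
  classical
  letI := 𝒜.gradedRing a
  -- the scalars `Γ(Spec k) → Γ(Y, W a)`, in degree `0`, of finite type
  letI alg : Algebra Γ(Spec (.of k), ⊤) Γ(Y, 𝒜.W a) := (f.appLE ⊤ (𝒜.W a) le_top).hom.toAlgebra
  have h0 : ∀ c : Γ(Spec (.of k), ⊤), algebraMap Γ(Spec (.of k), ⊤) Γ(Y, 𝒜.W a) c ∈ 𝒜.piece a 0 :=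
    𝒜.appLE_mem a
  have hA : Algebra.FiniteType Γ(Spec (.of k), ⊤) Γ(Y, 𝒜.W a) :=
    HasRingHomProperty.appLE @LocallyOfFiniteType f inferInstance ⟨⊤, isAffineOpen_top _⟩ (𝒜.W a)
      le_top
  -- the filtration of the centre on the chart: homogeneous, extended Rees algebra of finite type
  have hF : ∀ n, ((R'.filtration (𝒜.W a)).ideal n).IsHomogeneous (𝒜.piece a) := fun n => by
    rw [ReesFiltration.filtration_ideal, hR']
    exact hhom a n
  have hR : Algebra.FiniteType Γ(Y, 𝒜.W a) (R'.filtration (𝒜.W a)).extendedRees := by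
    change Algebra.FiniteType Γ(Y, 𝒜.W a) (R'.sectionsRing (𝒜.W a))
    rw [WeightedThesis.GlobalCobordantPlus.sectionsRing_eq_extReesAlgebra (D.centre f i.ker) R' hR'
      (𝒜.W a)]
    exact ExtReesRegular.finiteType f (D.centre f i.ker)
      (D.isRegularWeightedCentre_centre f i.ker hguard) (𝒜.W a)
  obtain ⟨d, hd, hver⟩ := veronese_degreeZero (𝒜.piece a) h0 hA (R'.filtration (𝒜.W a)) hF hR
  refine ⟨d, hd, fun d' hd' l x hx hx0 => ?_⟩
  have hx' : x ∈ (R'.filtration (𝒜.W a)).ideal (d' * (l + 1)) := by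
    rw [ReesFiltration.filtration_ideal, hR']
    exact hx
  have h := hver d' hd' l x hx' hx0
  simpa only [ReesFiltration.filtration_ideal, hR'] using h

end Chart

/-! ## The stub -/

/-- **STUB `stub_qs_degree`** of the line `Sketch` of crux `DatumToEmbedded`: **choice of the
Veronese degree.** Given the exceptional identity `J_D · 𝒪_{B₊} = (t⁻¹)^D` for all multiples `D`
of `N₀`, the degree `Dg := e · N₀ · ∏ₐ dₐ` (`e` the exponent of the atlas, `dₐ` the Veronese degrees
of the finitely many charts, `exists_veronese_chart`) is a positive multiple of `N₀` with (A2) on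
every chart the degree-`0` parts of the pieces `J_{Dg·l}(W a)` generated in degree one modulo the
ideal of `X` (even before reducing), and (A3) the downstairs centre
`K = ker (V(J_Dg·𝒪_X) ⟶ X ⟶ V) = q_*(J_Dg·𝒪_X)` pulling back to the `Dg`-th power of the exceptional
ideal on the strict transform: `⊆` because `q^*K ⊆ J_Dg·𝒪_X` and `J_Dg·𝒪_{X'} = (t⁻¹)^{Dg}`
((A1) along `σX ≫ i = ι' ≫ σ₊`), `⊇` by `pow_comap_le_comap_map` from (A1) at `Dg/e`
(Włodarczyk 2022, §2.3.3). [cite: Wlodarczyk2022, §2.3.3] -/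
theorem stub_qs_degree :
    ∀ {p : ℕ} (D : WeightedResolutionDatum p) {k : Type} [Field k] [CharP k p] [PerfectField k]
      {Y X V : Scheme.{0}} (f : Y ⟶ Spec (.of k)) [Smooth f] [IsSeparated f] [QuasiCompact f]
      (i : X ⟶ Y) [IsClosedImmersion i] [IsIntegral X] (q : X ⟶ V) [IsIntegral V]
      (g : V ⟶ Spec (.of k)) [IsSeparated g] [LocallyOfFiniteType g] [QuasiCompact g],
      q ≫ g = i ≫ f →
      ∀ {j : ℕ} (𝒜 : GradedAtlas j f i q), (∃ y : Y, ¬ IsBot (D.inv f i.ker y)) →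
      (∀ (a : 𝒜.ι) (n : ℕ), letI := 𝒜.gradedRing a;
        (((D.centre f i.ker).piece n).ideal (𝒜.W a)).IsHomogeneous (𝒜.piece a)) →
      ∀ (R' : ReesFiltration Y), R'.ideal = (D.centre f i.ker).piece →
      ∀ [IsIntegral (R'.strictTransformPlus i.ker).subscheme]
        (σX : (R'.strictTransformPlus i.ker).subscheme ⟶ X),
        σX ≫ i = (R'.strictTransformPlus i.ker).subschemeι ≫ R'.πPlus →
      ∀ (N₀ : ℕ), 0 < N₀ → (∀ Dg : ℕ, N₀ ∣ Dg →
        ((D.centre f i.ker).piece Dg).comap R'.πPlus = R'.excPlus ^ Dg) →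
      ∃ Dg : ℕ, 0 < Dg ∧ N₀ ∣ Dg ∧
        (∀ (a : 𝒜.ι) (l : ℕ) (x : Γ(Y, 𝒜.W a)),
          x ∈ ((D.centre f i.ker).piece (Dg * (l + 1))).ideal (𝒜.W a) → x ∈ 𝒜.piece a 0 →
          ∃ y ∈ AddSubgroup.closure
            {z : Γ(Y, 𝒜.W a) | ∃ u v : Γ(Y, 𝒜.W a),
              u ∈ ((D.centre f i.ker).piece Dg).ideal (𝒜.W a) ∧ u ∈ 𝒜.piece a 0 ∧
              v ∈ ((D.centre f i.ker).piece (Dg * l)).ideal (𝒜.W a) ∧ v ∈ 𝒜.piece a 0 ∧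
              z = u * v},
            x - y ∈ i.ker.ideal (𝒜.W a)) ∧
        (((((D.centre f i.ker).piece Dg).comap i).subschemeι ≫ q).ker).comap (σX ≫ q) =
          (R'.excPlus.comap (R'.strictTransformPlus i.ker).subschemeι) ^ Dg := by
  intro p D k _ _ _ Y X V f _ _ _ i _ _ q _ g _ _ _ hq j 𝒜 hguard hhom R' hR' _ σX hσX N₀ hN₀ hexc
  classical
  -- `q` is quasi-compact (it is `i ≫ f` followed by nothing worse than the separated `g`)
  haveI : QuasiCompact q := by
    haveI : QuasiCompact (q ≫ g) := by rw [hq]; infer_instance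
    exact .of_comp q g
  haveI : IsLocallyNoetherian Y := LocallyOfFiniteType.isLocallyNoetherian f
  haveI : Finite 𝒜.ι := 𝒜.finite_ι
  letI : Fintype 𝒜.ι := Fintype.ofFinite 𝒜.ι
  -- the Veronese degrees of the finitely many charts
  choose d hd hver using exists_veronese_chart D f i q 𝒜 hguard hhom R' hR'
  have hD'pos : 0 < N₀ * ∏ a, d a := Nat.mul_pos hN₀ (Finset.prod_pos fun a _ => hd a)
  refine ⟨𝒜.exponent * (N₀ * ∏ a, d a), Nat.mul_pos 𝒜.exponent_pos hD'pos,
    dvd_mul_of_dvd_right (dvd_mul_right N₀ _) _, ?_, ?_⟩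
  · -- (A2): `y := x` itself lies in the closure of the products, already in `Γ(Y, W a)`
    intro a l x hx hx0
    refine ⟨x, hver a _ (dvd_mul_of_dvd_right (dvd_mul_of_dvd_right
      (Finset.dvd_prod_of_mem d (Finset.mem_univ a)) N₀) _) l x hx hx0, ?_⟩
    rw [sub_self]
    exact Ideal.zero_mem _
  · -- (A3)
    -- the exceptional ideal on `X'` is `τ^*(x)` for the coordinate `τ = t⁻¹ : X' ⟶ B₊ ⟶ B ⟶ 𝔸¹`
    have hEeq : R'.excPlus.comap (R'.strictTransformPlus i.ker).subschemeι =
        (affineBlowup.idealSheaf (Ideal.span {Polynomial.X})).comap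
          ((R'.strictTransformPlus i.ker).subschemeι ≫ R'.plus.ι ≫ R'.toA1) := by
      rw [Scheme.IdealSheafData.comap_comp, Scheme.IdealSheafData.comap_comp]
      rfl
    -- (A1) pulled back to `X'` along `σX ≫ i = ι' ≫ σ₊`
    have hE : ∀ n : ℕ, N₀ ∣ n →
        ((affineBlowup.idealSheaf (Ideal.span {Polynomial.X})).comap
          ((R'.strictTransformPlus i.ker).subschemeι ≫ R'.plus.ι ≫ R'.toA1)) ^ n =
        ((D.centre f i.ker).piece n).comap (σX ≫ i) := by
      intro n hn
      rw [← hEeq, ← comap_pow, ← hexc n hn, ← Scheme.IdealSheafData.comap_comp, ← hσX]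
    change ((((D.centre f i.ker).piece (𝒜.exponent * (N₀ * ∏ a, d a))).comap i).map q).comap
      (σX ≫ q) = _
    apply le_antisymm
    · -- `⊆`: `q^* K ⊆ J_Dg · 𝒪_X`, and `J_Dg · 𝒪_{X'} = (t⁻¹)^{Dg}`
      rw [Scheme.IdealSheafData.comap_comp, hEeq,
        hE _ (dvd_mul_of_dvd_right (dvd_mul_right N₀ _) _), Scheme.IdealSheafData.comap_comp]
      exact Scheme.IdealSheafData.comap_mono σX (Scheme.IdealSheafData.comap_map_le _ _)
    · -- `⊇`: the heart
      rw [hEeq]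
      exact pow_comap_le_comap_map f i q 𝒜 (D.centre f i.ker).piece hhom
        (fun n e => piece_pow_le _ n e) σX _ (N₀ * ∏ a, d a) (hE _ (dvd_mul_right N₀ _))

/-- **Sub-goal `stub_qs_degree_explicit`** registered on the crux item for this file: the statement
of `stub_qs_degree` with the chart grading instance written explicitly (`@Ideal.IsHomogeneous …
(𝒜.gradedRing a) …` instead of `letI := 𝒜.gradedRing a; …`), definitionally the same
proposition. [cite: Wlodarczyk2022, §2.3.3] -/
theorem stub_qs_degree_explicit :
    ∀ {p : ℕ} (D : WeightedResolutionDatum p) {k : Type} [Field k] [CharP k p] [PerfectField k]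
      {Y X V : Scheme.{0}} (f : Y ⟶ Spec (.of k)) [Smooth f] [IsSeparated f] [QuasiCompact f]
      (i : X ⟶ Y) [IsClosedImmersion i] [IsIntegral X] (q : X ⟶ V) [IsIntegral V]
      (g : V ⟶ Spec (.of k)) [IsSeparated g] [LocallyOfFiniteType g] [QuasiCompact g],
      q ≫ g = i ≫ f →
      ∀ {j : ℕ} (𝒜 : GradedAtlas j f i q), (∃ y : Y, ¬ IsBot (D.inv f i.ker y)) →
      (∀ (a : 𝒜.ι) (n : ℕ), @Ideal.IsHomogeneous (Fin j → ℤ) (AddSubgroup Γ(Y, 𝒜.W a))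
        Γ(Y, 𝒜.W a) _ _ _ (𝒜.piece a) _ _ (𝒜.gradedRing a)
        (((D.centre f i.ker).piece n).ideal (𝒜.W a))) →
      ∀ (R' : ReesFiltration Y), R'.ideal = (D.centre f i.ker).piece →
      ∀ [IsIntegral (R'.strictTransformPlus i.ker).subscheme]
        (σX : (R'.strictTransformPlus i.ker).subscheme ⟶ X),
        σX ≫ i = (R'.strictTransformPlus i.ker).subschemeι ≫ R'.πPlus →
      ∀ (N₀ : ℕ), 0 < N₀ → (∀ Dg : ℕ, N₀ ∣ Dg →
        ((D.centre f i.ker).piece Dg).comap R'.πPlus = R'.excPlus ^ Dg) →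
      ∃ Dg : ℕ, 0 < Dg ∧ N₀ ∣ Dg ∧
        (∀ (a : 𝒜.ι) (l : ℕ) (x : Γ(Y, 𝒜.W a)),
          x ∈ ((D.centre f i.ker).piece (Dg * (l + 1))).ideal (𝒜.W a) → x ∈ 𝒜.piece a 0 →
          ∃ y ∈ AddSubgroup.closure
            {z : Γ(Y, 𝒜.W a) | ∃ u v : Γ(Y, 𝒜.W a),
              u ∈ ((D.centre f i.ker).piece Dg).ideal (𝒜.W a) ∧ u ∈ 𝒜.piece a 0 ∧
              v ∈ ((D.centre f i.ker).piece (Dg * l)).ideal (𝒜.W a) ∧ v ∈ 𝒜.piece a 0 ∧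
              z = u * v},
            x - y ∈ i.ker.ideal (𝒜.W a)) ∧
        (((((D.centre f i.ker).piece Dg).comap i).subschemeι ≫ q).ker).comap (σX ≫ q) =
          (R'.excPlus.comap (R'.strictTransformPlus i.ker).subschemeι) ^ Dg := by
  intro p D k _ _ _ Y X V f _ _ _ i _ _ q _ g _ _ _ hq j 𝒜 hguard hhom R' hR' _ σX hσX N₀ hN₀ hexc
  exact stub_qs_degree D f i q g hq 𝒜 hguard hhom R' hR' σX hσX N₀ hN₀ hexc

end Summit.ResolutionOfSingularities.ResolutionOfSingularities.Theorems.DatumToEmbedded.Degree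

end
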